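import Literature.NumberTheory.NumberFields.PlacesAboveGaloisOrbits
import Literature.NumberTheory.GaloisRepresentations.SUnitsValuation
import Literature.NumberTheory.DiophantineGeometry.SUnitTheorem
import Literature.RepresentationTheory.InvariantsBaseChange
import Literature.RepresentationTheory.FiniteGroups.RationalRepresentationCyclicInvariants
import Literature.RepresentationTheory.FiniteGroups.WeaklyIsomorphicPermutationRepresentations
import Mathlib.Algebra.Group.Action.Sum
import Mathlib.RingTheory.TensorProduct.Finite
import HarnessLib

/-!
# Herbrand's equivariant `S`-unit theorem: `(𝒪_{E,S}^×)^H = 𝒪_{E^H,S}^×`,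
# `rk (𝒪_{E,S}^×)^H + 1 = #((S_E ⊔ S_∞(E))/H)`, and `(ℚ ⊗ 𝒪_{E,S}^×) ⊕ ℚ ≅ ℚ[S_E ⊔ S_∞(E)]`

Topic `NumberTheory/NumberFields`; namespace `Literature.NumberTheory.NumberFields.EquivariantSUnit`.
Definitions with bodies (an abbreviation `sUnitsRepρ`, the inclusion `sUnitsFixedFieldIncl` and the
linear map / equivalence `sUnitsFixedFieldToInvariants`, `sUnitsFixedFieldEquivInvariants`; no instance,
no notation) and theorems; no named fact, no `sorry`.  Sequel of `PlacesAboveGaloisOrbits.lean`; brick B7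
(rational form «B7b») of lane «TATE-EPC-TC» of cell `bsd-eis` (crux `GoodLatticeBDPValue`,
stmt-BirchSwinnertonDyer-19032): the Galois-module structure of the `S`-units that enters Tate's global
Euler–Poincaré characteristic at a totally complex field through `[𝒪_{L,S}^×/p]`.

Setting: number fields `K ⊆ F ⊆ E`, `E/F` Galois with group `G`, `S` a FINITE set of finite places of
`K`; `𝒪_{E,S}^×` = the tree's `SUnits.sUnits K S E` (units of `E` integral with their inverses over
`𝒪_{K,S}`; = Mathlib's `S_E.unit E` by `sUnits_eq_unit_setOf_under_mem`) with its `G`-module structure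
`sUnitsRep K S F E` (here as the bare representation `sUnitsRepρ`).

* §3 **`mem_invariants_sUnitsRep_iff`** (`x ∈ (𝒪_{E,S}^×)^H ⟺ x ∈ E^H`),
  **`sUnitsFixedFieldEquivInvariants H : 𝒪_{E^H,S}^× ≃ₗ[ℤ] (𝒪_{E,S}^×)^H`**, and by Dirichlet's
  `S`-unit theorem for `E^H` (tree `DiophantineGeometry.NumberField.finrank_sUnit`)
  **`finrank_invariants_sUnitsRep`**: `rk_ℤ (𝒪_{E,S}^×)^H = rank(E^H) + #S_{E^H}`.
* §4 **`finrank_invariants_sUnitsRep_add_one_eq_natCard_orbitRelQuotient`**: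
  `rk_ℤ (𝒪_{E,S}^×)^H + 1 = #((S_E ⊔ S_∞(E))/H)` for every `H ≤ G`, and HERBRAND'S THEOREM
  **`nonempty_equiv_sUnitsRep_baseChange_prod_trivial_ofMulAction`**:
  `(ℚ ⊗_ℤ 𝒪_{E,S}^×) ⊕ 𝟙 ≅ ℚ[S_E ⊔ S_∞(E)]` as `ℚ[G]`-modules (`repBaseChange ℚ`, Mathlib
  `Representation.prod` / `trivial` / `ofMulAction`), by Serre's criterion (a rational representation
  is determined by `dim V^C` over the cyclic subgroups: tree
  `RationalRepresentationCyclicInvariants.nonempty_equiv_iff_forall_finrank_invariants_zpowers_eq`),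
  the flat base change of invariants (`InvariantsBaseChange.finrank_invariants_repBaseChange`) and
  `dim ℚ[X]^H = #(X/H)` (`WeaklyIsomorphicPermutationRepresentations.finrank_invariants_ofMulAction_comp_subtype`).

Cassels–Fröhlich VII §8.3 proves the real form (the log-lattice `λ(L_T)` and `ℤ^T` span the same
`ℝ[G]`-module); (8.7.2) of Neukirch–Schmidt–Wingberg is the rational form `E_S ⊗ ℚ ⊕ ℚ ≅ ⊕_{𝔭 ∈ S}
Ind_{G_𝔓}^G ℚ`.  The proof here is by counting invariants instead of logarithms.  Deliberately NOT here:
the mod-`p` form `[𝒪_{E,S}^×/p] + [𝔽_p] = [μ(E)[p]] + [𝔽_p[S_E ⊔ S_∞(E)]]` (brick «B7c», which needs a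
lattice-index lemma), and any statement about archimedean `S` inside `K` (the tree's `S` is a set of
finite places; the archimedean places enter as `InfinitePlace E`).

## References
* [CasselsFrohlichANT1967] Cassels–Fröhlich, *Algebraic Number Theory*, Ch. VII (Tate) §8.3.
* [NeukirchSchmidtWingberg2008] Neukirch–Schmidt–Wingberg, *Cohomology of Number Fields*, VIII §3
  (`E_{K,S}`), (8.7.2).
* [Omeara1963] O. T. O'Meara, *Introduction to Quadratic Forms*, §33F Thm. 33:10 (`S`-unit theorem).
* [SerreLinearRepresentations1977] J.-P. Serre, *Linear Representations of Finite Groups*, §13.1 Cor.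
  to Thm. 30.
-/

noncomputable section

open NumberField IsDedekindDomain Module Representation MulAction
open Literature.NumberTheory.GaloisRepresentations.SUnits

namespace Literature.NumberTheory.NumberFields

namespace EquivariantSUnit

/-! ## §3 The `H`-invariants of `𝒪_{E,S}^×` are the `S`-units of the fixed field `E^H` -/

section Invariants

variable (K : Type) [Field K] [NumberField K] (S : Set (HeightOneSpectrum (𝓞 K)))
  (F E : Type) [Field F] [Field E] [NumberField E]
  [Algebra K F] [Algebra K E] [Algebra F E] [IsScalarTower K F E]

/-- **`𝒪_{E,S}^×` as a bare `ℤ`-linear representation of `Gal(E/F)`** on `Additive (sUnits K S E)` with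
its native `ℤ`-module structure: the `ρ` of the tree's `Rep`-object `sUnitsRep K S F E` (an
abbreviation; it avoids the `ModuleCat`-carrier instance path when extending scalars to `ℚ`).
[cite: NeukirchSchmidtWingberg2008, VIII §3 (`E_{K,S} = 𝒪_{K,S}^×` as a `G`-module)] -/
abbrev sUnitsRepρ : Representation ℤ (E ≃ₐ[F] E) (Additive (sUnits K S E)) := (sUnitsRep K S F E).ρ

variable {K S F E}

omit [NumberField E] in
/-- The Galois action of `sUnitsRepρ` read on `E`: `↑↑(σ • x) = σ ↑↑x`.
[cite: NeukirchSchmidtWingberg2008, VIII §3] -/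
theorem coe_coe_toMul_sUnitsRepρ (σ : E ≃ₐ[F] E) (x : Additive (sUnits K S E)) :
    (((Additive.toMul (sUnitsRepρ K S F E σ x) : sUnits K S E) : Eˣ) : E) =
      σ (((Additive.toMul x : sUnits K S E) : Eˣ) : E) := by
  rfl

omit [NumberField E] in
/-- **`x ∈ (𝒪_{E,S}^×)^H ⟺ x ∈ E^H`**: an `S`-unit is fixed by the subgroup `H ≤ Gal(E/F)` iff its
underlying element lies in the fixed field. [cite: NeukirchSchmidtWingberg2008, VIII §3] -/
theorem mem_invariants_sUnitsRep_iff (H : Subgroup (E ≃ₐ[F] E)) (x : Additive (sUnits K S E)) :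
    x ∈ invariants ((sUnitsRepρ K S F E).comp H.subtype) ↔
      (((Additive.toMul x : sUnits K S E) : Eˣ) : E) ∈ IntermediateField.fixedField H := by
  rw [mem_invariants, IntermediateField.mem_fixedField_iff]
  constructor
  · intro h f hf
    have := congrArg (fun y : Additive (sUnits K S E) => (((Additive.toMul y : sUnits K S E) : Eˣ) : E))
      (h ⟨f, hf⟩)
    simpa only [MonoidHom.coe_comp, Function.comp_apply, Subgroup.coe_subtype,
      coe_coe_toMul_sUnitsRepρ] using this
  · intro h f
    apply (Additive.toMul (α := sUnits K S E)).injective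
    apply Subtype.ext
    apply Units.ext
    rw [MonoidHom.coe_comp, Function.comp_apply, Subgroup.coe_subtype, coe_coe_toMul_sUnitsRepρ]
    exact h f f.2

/-- The inclusion `𝒪_{E^H,S}^× → 𝒪_{E,S}^×` of `S`-units (over `K`) along `E^H ⊆ E`, as a
homomorphism of unit groups. [cite: NeukirchSchmidtWingberg2008, VIII §3 (`E_{K,S} ⊆ E_{L,S}`)] -/
def sUnitsFixedFieldIncl (H : Subgroup (E ≃ₐ[F] E)) :
    sUnits K S (IntermediateField.fixedField H) →* sUnits K S E :=
  ((Units.map (((IntermediateField.fixedField H).val.restrictScalars K :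
      IntermediateField.fixedField H →ₐ[K] E) : IntermediateField.fixedField H →* E)).comp
    (sUnits K S (IntermediateField.fixedField H)).subtype).codRestrict (sUnits K S E)
    fun u => map_mem_sUnits _ u.2

omit [NumberField E] in
/-- Underlying element: `↑↑(ι u) = ↑↑↑u ∈ E`. [cite: NeukirchSchmidtWingberg2008, VIII §3] -/
@[simp] theorem coe_coe_sUnitsFixedFieldIncl (H : Subgroup (E ≃ₐ[F] E))
    (u : sUnits K S (IntermediateField.fixedField H)) :
    (((sUnitsFixedFieldIncl H u : sUnits K S E) : Eˣ) : E) =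
      (((u : (IntermediateField.fixedField H)ˣ) : IntermediateField.fixedField H) : E) := rfl

/-- The inclusion `𝒪_{E^H,S}^× → 𝒪_{E,S}^×`, additively and `ℤ`-linearly, landing in the `H`-invariants.
[cite: NeukirchSchmidtWingberg2008, VIII §3 (`E_{K,S} ⊆ E_{L,S}`)] -/
def sUnitsFixedFieldToInvariants (H : Subgroup (E ≃ₐ[F] E)) :
    Additive (sUnits K S (IntermediateField.fixedField H)) →ₗ[ℤ]
      invariants ((sUnitsRepρ K S F E).comp H.subtype) :=
  LinearMap.codRestrict (invariants ((sUnitsRepρ K S F E).comp H.subtype))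
    ((MonoidHom.toAdditive (sUnitsFixedFieldIncl H)).toIntLinearMap :
      Additive (sUnits K S (IntermediateField.fixedField H)) →ₗ[ℤ] Additive (sUnits K S E))
    fun u => by
      rw [mem_invariants_sUnitsRep_iff]
      exact (((Additive.toMul u : sUnits K S (IntermediateField.fixedField H)) :
        (IntermediateField.fixedField H)ˣ) : IntermediateField.fixedField H).2

omit [NumberField E] in
/-- Underlying element of the image: `↑↑↑(ι u) = ↑↑↑u ∈ E`. [cite: NeukirchSchmidtWingberg2008, VIII §3] -/
theorem coe_sUnitsFixedFieldToInvariants (H : Subgroup (E ≃ₐ[F] E))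
    (u : Additive (sUnits K S (IntermediateField.fixedField H))) :
    (((Additive.toMul ((sUnitsFixedFieldToInvariants H u :
        invariants ((sUnitsRepρ K S F E).comp H.subtype)) : Additive (sUnits K S E)) :
          sUnits K S E) : Eˣ) : E) =
      ((((Additive.toMul u : sUnits K S (IntermediateField.fixedField H)) :
        (IntermediateField.fixedField H)ˣ) : IntermediateField.fixedField H) : E) := rfl

omit [NumberField E] in
/-- **`𝒪_{E^H,S}^× ≅ (𝒪_{E,S}^×)^H`** (as `ℤ`-modules): the inclusion is injective and every
`H`-fixed `S`-unit of `E` is an `S`-unit of `E^H` (integrality over `𝒪_{K,S}` is intrinsic, tree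
`map_mem_sUnits_iff`). [cite: NeukirchSchmidtWingberg2008, VIII §3 (`E_{K,S}`, `E_{L,S}`)] -/
theorem bijective_sUnitsFixedFieldToInvariants (H : Subgroup (E ≃ₐ[F] E)) :
    Function.Bijective (sUnitsFixedFieldToInvariants (K := K) (S := S) H) := by
  set M := IntermediateField.fixedField H
  constructor
  · intro u v huv
    have h := congrArg (fun y : invariants ((sUnitsRepρ K S F E).comp H.subtype) =>
      (((Additive.toMul (y : Additive (sUnits K S E)) : sUnits K S E) : Eˣ) : E)) huv
    simp only [coe_sUnitsFixedFieldToInvariants] at h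
    exact (Additive.toMul (α := sUnits K S M)).injective (Subtype.ext (Units.ext (Subtype.ext h)))
  · intro x
    have hx : (((Additive.toMul (x : Additive (sUnits K S E)) : sUnits K S E) : Eˣ) : E) ∈ M :=
      (mem_invariants_sUnitsRep_iff H _).1 x.2
    have hx0 : (⟨_, hx⟩ : M) ≠ 0 := fun h0 =>
      ((Additive.toMul (x : Additive (sUnits K S E)) : sUnits K S E) : Eˣ).ne_zero (congrArg Subtype.val h0)
    let uM : Mˣ := Units.mk0 _ hx0
    have huM : Units.map ((M.val.restrictScalars K : M →ₐ[K] E) : M →* E) uM =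
        ((Additive.toMul (x : Additive (sUnits K S E)) : sUnits K S E) : Eˣ) := Units.ext rfl
    have hmem : uM ∈ sUnits K S M := by
      rw [← map_mem_sUnits_iff (M.val.restrictScalars K), huM]
      exact ((Additive.toMul (x : Additive (sUnits K S E)) : sUnits K S E)).2
    refine ⟨Additive.ofMul ⟨uM, hmem⟩, Subtype.ext ?_⟩
    apply (Additive.toMul (α := sUnits K S E)).injective
    exact Subtype.ext huM

/-- **The `ℤ`-linear isomorphism `𝒪_{E^H,S}^× ≃ (𝒪_{E,S}^×)^H`.**
[cite: NeukirchSchmidtWingberg2008, VIII §3 (`E_{K,S}`, `E_{L,S}`)] -/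
def sUnitsFixedFieldEquivInvariants (H : Subgroup (E ≃ₐ[F] E)) :
    Additive (sUnits K S (IntermediateField.fixedField H)) ≃ₗ[ℤ]
      invariants ((sUnitsRepρ K S F E).comp H.subtype) :=
  LinearEquiv.ofBijective _ (bijective_sUnitsFixedFieldToInvariants H)

variable [NumberField F]

/-- **`rk_ℤ (𝒪_{E,S}^×)^H = rank(E^H) + #S_{E^H}`** (`S` finite; `rank = #S_∞ − 1`): the `H`-invariants
are the `S`-units of `E^H`, whose rank is given by Dirichlet's `S`-unit theorem (tree `finrank_sUnit`)
once `𝒪_{E^H,S}^×` is identified with Mathlib's `S_{E^H}.unit` (tree `sUnits_eq_unit_setOf_under_mem`).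
[cite: Omeara1963, §33F Thm. 33:10] [cite: NeukirchSchmidtWingberg2008, VIII §3] -/
theorem finrank_invariants_sUnitsRep (hS : S.Finite) (H : Subgroup (E ≃ₐ[F] E)) :
    finrank ℤ (invariants ((sUnitsRepρ K S F E).comp H.subtype)) =
      Units.rank (IntermediateField.fixedField H) +
        Nat.card {u : HeightOneSpectrum (𝓞 (IntermediateField.fixedField H)) | u.under (𝓞 K) ∈ S} := by
  set M := IntermediateField.fixedField H
  haveI : Finite {u : HeightOneSpectrum (𝓞 M) | u.under (𝓞 K) ∈ S} :=
    (finite_setOf_under_mem K M hS).to_subtype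
  rw [← (sUnitsFixedFieldEquivInvariants H).finrank_eq]
  have h := sUnits_eq_unit_setOf_under_mem (K := K) (S := S) (E := M)
  rw [h]
  exact DiophantineGeometry.NumberField.finrank_sUnit _

end Invariants

/-! ## §4 Herbrand's theorem: the rank identity for every `H` and the `ℚ[G]`-isomorphism -/

section Herbrand

/-- Orbits of a disjoint union: `(α ⊔ β)/G ≃ α/G ⊔ β/G`. [folklore] -/
private def orbitRelQuotientSumEquiv (G : Type*) [Group G] (α β : Type*) [MulAction G α]
    [MulAction G β] :
    orbitRel.Quotient G (α ⊕ β) ≃ orbitRel.Quotient G α ⊕ orbitRel.Quotient G β where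
  toFun := Quotient.lift
    (Sum.elim (fun a => Sum.inl (⟦a⟧ : orbitRel.Quotient G α))
      (fun b => Sum.inr (⟦b⟧ : orbitRel.Quotient G β)))
    (by
      rintro x y ⟨g, rfl⟩
      rcases y with a | b
      · show Sum.elim _ _ (g • Sum.inl a : α ⊕ β) = _
        rw [Sum.smul_inl]
        exact congrArg Sum.inl (Quotient.sound ⟨g, rfl⟩)
      · show Sum.elim _ _ (g • Sum.inr b : α ⊕ β) = _
        rw [Sum.smul_inr]
        exact congrArg Sum.inr (Quotient.sound ⟨g, rfl⟩))
  invFun := Sum.elim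
    (Quotient.lift (fun a => (⟦Sum.inl a⟧ : orbitRel.Quotient G (α ⊕ β)))
      (by rintro a a' ⟨g, rfl⟩; exact Quotient.sound ⟨g, rfl⟩))
    (Quotient.lift (fun b => (⟦Sum.inr b⟧ : orbitRel.Quotient G (α ⊕ β)))
      (by rintro b b' ⟨g, rfl⟩; exact Quotient.sound ⟨g, rfl⟩))
  left_inv := by
    rintro ⟨x⟩
    cases x with
    | inl a => rfl
    | inr b => rfl
  right_inv := by
    rintro (⟨⟨a⟩⟩ | ⟨⟨b⟩⟩) <;> rfl

/-- `#((α ⊔ β)/G) = #(α/G) + #(β/G)` for finite `α`, `β`. [folklore] -/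
private theorem natCard_orbitRelQuotient_sum (G : Type*) [Group G] (α β : Type*) [MulAction G α]
    [MulAction G β] [Finite α] [Finite β] :
    Nat.card (orbitRel.Quotient G (α ⊕ β)) =
      Nat.card (orbitRel.Quotient G α) + Nat.card (orbitRel.Quotient G β) := by
  rw [Nat.card_congr (orbitRelQuotientSumEquiv G α β), Nat.card_sum]

variable {K : Type} [Field K] [NumberField K] {S : Set (HeightOneSpectrum (𝓞 K))}
  {F E : Type} [Field F] [NumberField F] [Field E] [NumberField E]
  [Algebra K F] [Algebra K E] [Algebra F E] [IsScalarTower K F E] [IsGalois F E]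

/-- **Herbrand's `S`-unit theorem, rank form, for every subgroup**: for `K ⊆ F ⊆ E` number fields with
`E/F` Galois, `S` a finite set of finite places of `K` and `H ≤ Gal(E/F)`,
`rk_ℤ (𝒪_{E,S}^×)^H + 1 = #((S_E ⊔ S_∞(E))/H)`: both sides equal `#S_{E^H} + #S_∞(E^H)` (Dirichlet's
`S`-unit theorem for `E^H` on the left; transitivity of `Gal(E/E^H)` on the places above a given place
on the right).  This is the character-free content of the `ℚ[G]`-isomorphism
`(ℚ ⊗ 𝒪_{E,S}^×) ⊕ ℚ ≅ ℚ[S_E ⊔ S_∞(E)]`. [cite: NeukirchSchmidtWingberg2008, (8.7.2)]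
[cite: CasselsFrohlichANT1967, Ch. VII §8.3 (the lattices `M = λ(L_T) + ℤg` and `N = ℤ^T` span the same `G`-space)] -/
theorem finrank_invariants_sUnitsRep_add_one_eq_natCard_orbitRelQuotient (hS : S.Finite)
    (H : Subgroup (E ≃ₐ[F] E)) :
    finrank ℤ (invariants ((sUnitsRepρ K S F E).comp H.subtype)) + 1 =
      Nat.card (orbitRel.Quotient H (placesAbove K S F E ⊕ InfinitePlace E)) := by
  haveI : Finite (placesAbove K S F E) := finite_placesAbove hS
  rw [natCard_orbitRelQuotient_sum, natCard_orbitRelQuotient_placesAbove,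
    natCard_orbitRelQuotient_infinitePlace, finrank_invariants_sUnitsRep hS, Units.rank]
  have hpos : 0 < Fintype.card (InfinitePlace (IntermediateField.fixedField H)) := Fintype.card_pos
  omega

/-- **Herbrand's `S`-unit theorem (rational form): `(ℚ ⊗_ℤ 𝒪_{E,S}^×) ⊕ ℚ ≅ ℚ[S_E ⊔ S_∞(E)]` as
`ℚ[Gal(E/F)]`-modules** — for `K ⊆ F ⊆ E` number fields with `E/F` Galois and `S` a finite set of finite
places of `K`; `S_E` = the places of `E` above `S` (`placesAbove`), `S_∞(E)` = `InfinitePlace E`, both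
with their Galois actions; the `S`-unit side is the extension of scalars `repBaseChange ℚ` of the tree's
`sUnitsRep K S F E` (`𝒪_{E,S}^×` as a `ℤ[Gal(E/F)]`-module) plus the unit representation.  Proof: a
rational representation is determined by the dimensions of the invariants of the cyclic subgroups (Serre
§13.1, Cor. to Thm. 30: tree `nonempty_equiv_iff_forall_finrank_invariants_zpowers_eq`); these are
`rk (𝒪_{E,S}^×)^C + 1` (invariants commute with the flat base change `ℤ → ℚ`) and `#((S_E ⊔ S_∞(E))/C)`,
equal by the rank form. [cite: NeukirchSchmidtWingberg2008, (8.7.2)]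
[cite: CasselsFrohlichANT1967, Ch. VII §8.3] [cite: SerreLinearRepresentations1977, §13.1 Cor. to Thm. 30] -/
theorem nonempty_equiv_sUnitsRep_baseChange_prod_trivial_ofMulAction (hS : S.Finite) :
    Nonempty (((Literature.RepresentationTheory.IntertwiningBaseChange.repBaseChange ℚ
        (sUnitsRepρ K S F E)).prod (Representation.trivial ℚ (E ≃ₐ[F] E) ℚ)).Equiv
      (Representation.ofMulAction ℚ (E ≃ₐ[F] E) (placesAbove K S F E ⊕ InfinitePlace E))) := by
  classical
  haveI : Finite (placesAbove K S F E) := finite_placesAbove hS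
  letI : Fintype (placesAbove K S F E) := Fintype.ofFinite _
  haveI : Finite {w : HeightOneSpectrum (𝓞 E) | w.under (𝓞 K) ∈ S} :=
    (finite_setOf_under_mem K E hS).to_subtype
  haveI : Module.Finite ℤ (Additive (sUnits K S E)) := by
    rw [sUnits_eq_unit_setOf_under_mem (K := K) (S := S) (E := E)]
    infer_instance
  haveI : Module.Flat ℤ ℚ := IsLocalization.flat ℚ (nonZeroDivisors ℤ)
  refine (Literature.RepresentationTheory.FiniteGroups.nonempty_equiv_iff_forall_finrank_invariants_zpowers_eq
    _ _).2 fun x => ?_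
  rw [Literature.RepresentationTheory.finrank_invariants_prod,
    Literature.RepresentationTheory.finrank_invariants_repBaseChange,
    Literature.RepresentationTheory.finrank_invariants_trivial_self,
    Literature.RepresentationTheory.FiniteGroups.finrank_invariants_ofMulAction_comp_subtype,
    finrank_invariants_sUnitsRep_add_one_eq_natCard_orbitRelQuotient hS]

end Herbrand

end EquivariantSUnit

end Literature.NumberTheory.NumberFields

end
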